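import Literature.MathematicalPhysics.QuantumLattice.SpinTwistedHubbardTorus
import Literature.MathematicalPhysics.QuantumLattice.FermionOperatorsProofs
import Literature.MathematicalPhysics.QuantumLattice.HubbardModelProofs
import HarnessLib

/-!
# Yang's `η`-pairing symmetry survives the spin twist

Trunk T-QLATTICE, family `hubbard`; companion of
`Literature/MathematicalPhysics/QuantumLattice/SpinTwistedHubbardTorus.lean` (route
`HubbardSuperconductivity/NodalDiracTwist`, crux `NodalDiracWeakCoupling`).

The spin-twisted Hubbard torus in the boost gauge,
`H_L(U, φ) = -Σ_{x,μ,σ} (e^{i(-1)^σ φ_μ/L} c†_{xσ} c_{x+e_μ,σ} + h.c.) + U Σ_x n_{x↑} n_{x↓}`, couples the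
two spin species to OPPOSITE twists. A spin gauge field does not see Yang's spin-singlet, charge-two
pair creator `η† = Σ_x (-1)^{x₀+x₁} c†_{x↑} c†_{x↓}`: the phase `e^{iφ_μ/L}` picked up by `↑` on the
bond `x → x + e_μ` equals the phase picked up by `↓` on the reversed bond, so the four commutator
terms of a bond cancel in pairs exactly as in Yang's untwisted computation, for EVERY `φ ∈ ℝ²`
(`spinTwistedHopping_commute_etaRaise`). Hence `[H_L(U, φ), η†] = U η†`
(`spinTwistedHubbardTorus_commutator_etaRaise`), `[H_L(U, φ), η] = -U η`, and the pseudospin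
Casimir part `η†η` is conserved (`spinTwistedHubbardTorus_commute_etaRaise_mul_etaLower`): the
pseudospin `SU(2)` of the even torus is an exact symmetry of the whole twist family, while the spin
`SU(2)` is broken to `U(1)` by the twist.

Sources: C. N. Yang, PRL **63** (1989) 2144, eq. (6) (`[H, η†] = U η†` on a bipartite lattice);
C. N. Yang, S. C. Zhang, Mod. Phys. Lett. B **4** (1990) 759, Theorem 1 (pseudospin `SU(2)`);
S. C. Zhang, PRL **65** (1990) 120 (pseudospin symmetry); twisted boundary conditions with
`θ^↑ = -θ^↓`: Karakuzu–Seki–Sorella, PRB **98** (2018) 075156, Sec. II D; Shastry–Sutherland,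
PRL **65** (1990) 243. The twisted statement is the same one-line computation as Yang's eq. (6)
(the bond phases are spin-antisymmetric, the pair is a spin singlet); we record it as folklore.
-/

noncomputable section

namespace Literature.MathematicalPhysics.QuantumLattice

open Matrix Finset HubbardWave0 Literature.Probability.LatticeModels

variable {L : ℕ} [NeZero L]

/-- One forward lattice step flips the staggering sign on the torus of even side:
`ε_{x+e_μ} = -ε_x`. Lieb, PRL 62 (1989) 1201 (bipartite hypercubic lattices). [folklore] -/
theorem torusStagger_shift {d : ℕ} (hL : Even L) (x : FermionTorus d L) (μ : Fin d) :
    torusStagger (FermionTorus.shift x μ) = -torusStagger x :=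
  torusStagger_eq_neg_of_toTorusSite_eq hL (FermionTorus.toTorusSite_shift x μ)

/-- **One twisted bond commutes with `η†`.** For sites `x, y` of opposite staggering sign and
amplitudes `a, b`, the spin-antisymmetrically twisted bond operator
`a c†_{x↑}c_{y↑} + b c†_{y↑}c_{x↑} + b c†_{x↓}c_{y↓} + a c†_{y↓}c_{x↓}` (spin `↓` carries the
amplitudes of the reversed bond) commutes with `η†_ε = Σ_z ε_z c†_{z↑} c†_{z↓}`: by
`hopTerm_commutator_etaRaise` the commutator is
`a ε_y c†_{x↑}c†_{y↓} + b ε_x c†_{y↑}c†_{x↓} - b ε_y c†_{x↓}c†_{y↑} - a ε_x c†_{y↓}c†_{x↑}`, and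
`c†_{y↓}c†_{x↑} = -c†_{x↑}c†_{y↓}`, `c†_{x↓}c†_{y↑} = -c†_{y↑}c†_{x↓}` leave the factor
`ε_x + ε_y = 0`. Yang, PRL 63 (1989) 2144, eq. (6) (untwisted, `a = b`). [folklore] -/
theorem twistedBond_commute_etaRaise {Λ : Type*} [LinearOrder Λ] [Fintype Λ] (ε : Λ → ℤˣ)
    {x y : Λ} (hxy : ε y = -ε x) (a b : ℂ) :
    (a • (creation (orb x 0) * annihilation (orb y 0)) +
        b • (creation (orb y 0) * annihilation (orb x 0)) +
        (b • (creation (orb x 1) * annihilation (orb y 1)) +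
          a • (creation (orb y 1) * annihilation (orb x 1)))) * etaRaise ε =
      etaRaise ε * (a • (creation (orb x 0) * annihilation (orb y 0)) +
        b • (creation (orb y 0) * annihilation (orb x 0)) +
        (b • (creation (orb x 1) * annihilation (orb y 1)) +
          a • (creation (orb y 1) * annihilation (orb x 1)))) := by
  rw [← sub_eq_zero]
  have lin : ∀ (A B C D : Matrix (Finset (Orb Λ)) (Finset (Orb Λ)) ℂ),
      (a • A + b • B + (b • C + a • D)) * etaRaise ε - etaRaise ε * (a • A + b • B + (b • C + a • D)) =
        a • (A * etaRaise ε - etaRaise ε * A) + b • (B * etaRaise ε - etaRaise ε * B) +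
          (b • (C * etaRaise ε - etaRaise ε * C) + a • (D * etaRaise ε - etaRaise ε * D)) := by
    intro A B C D
    simp only [add_mul, mul_add, smul_mul_assoc, mul_smul_comm, smul_sub]
    abel
  rw [lin, hopTerm_commutator_etaRaise, hopTerm_commutator_etaRaise, hopTerm_commutator_etaRaise,
    hopTerm_commutator_etaRaise, if_pos rfl, if_pos rfl, if_neg (show (1 : Fin 2) ≠ 0 by decide),
    if_neg (show (1 : Fin 2) ≠ 0 by decide), hxy, creation_mul_creation_eq_neg (orb y 1) (orb x 0),
    creation_mul_creation_eq_neg (orb x 1) (orb y 0), Units.val_neg, Int.cast_neg]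
  simp only [smul_neg, neg_smul, neg_neg, smul_smul]
  abel

/-- **The spin-twisted hopping commutes with Yang's `η†` for every twist.** On the torus
`(ℤ/Lℤ)²` of even side, `[T_L(φ), η†_ε] = 0` for the staggering sign `ε_x = (-1)^{x₀+x₁}` and
every `φ ∈ ℝ²`: bond by bond (`twistedBond_commute_etaRaise` with `a = e^{iφ_μ/L}`,
`b = e^{-iφ_μ/L}`, `ε_{x+e_μ} = -ε_x`). Yang, PRL 63 (1989) 2144, eq. (6) (the case `φ = 0`);
the spin-antisymmetric twist `θ^↑ = -θ^↓` of Karakuzu–Seki–Sorella, PRB 98 (2018) 075156,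
Sec. II D, leaves the computation unchanged. [folklore] -/
theorem spinTwistedHopping_commute_etaRaise (hL : Even L) (φ : Fin 2 → ℝ) :
    spinTwistedHopping L φ * etaRaise torusStagger =
      etaRaise torusStagger * spinTwistedHopping L φ := by
  unfold spinTwistedHopping
  simp only [sum_mul, mul_sum]
  refine sum_congr rfl fun x _ => sum_congr rfl fun μ _ => ?_
  rw [Fin.sum_univ_two, Fin.sum_univ_two, ← add_mul, ← mul_add]
  simp only [Fin.val_zero, Fin.val_one, pow_zero, pow_one, one_mul, neg_one_mul, neg_div,
    Complex.ofReal_neg, mul_neg, neg_neg]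
  exact twistedBond_commute_etaRaise torusStagger (torusStagger_shift hL x μ) _ _

/-- **Yang's commutator for the spin-twisted torus**: `[H_L(U, φ), η†_ε] = U η†_ε` for every
twist `φ ∈ ℝ²`, every `U` and the staggering sign `ε` of the even torus — the hopping part commutes
with `η†` (`spinTwistedHopping_commute_etaRaise`) and the on-site interaction contributes `U η†`
(`interaction_commutator_etaRaise`). Yang, PRL 63 (1989) 2144, eq. (6); Yang–Zhang, Mod. Phys.
Lett. B 4 (1990) 759, Theorem 1. [folklore] -/
theorem spinTwistedHubbardTorus_commutator_etaRaise (hL : Even L) (U : ℝ) (φ : Fin 2 → ℝ) :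
    spinTwistedHubbardTorus L U φ * etaRaise torusStagger -
        etaRaise torusStagger * spinTwistedHubbardTorus L U φ =
      (U : ℂ) • etaRaise torusStagger := by
  have hT := spinTwistedHopping_commute_etaRaise hL φ
  have hV : (∑ x : FermionTorus 2 L, numberOp x 0 * numberOp x 1) * etaRaise torusStagger =
      etaRaise torusStagger + etaRaise torusStagger * ∑ x : FermionTorus 2 L, numberOp x 0 * numberOp x 1 :=
    sub_eq_iff_eq_add.1 (interaction_commutator_etaRaise torusStagger)
  simp only [spinTwistedHubbardTorus, add_mul, mul_add, neg_mul, mul_neg, smul_mul_assoc,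
    mul_smul_comm, hT, hV, smul_add]
  abel

/-- **Both ladder relations**: `H η† = U η† + η† H` and `η H = U η + H η` (`η = (η†)ᴴ =
etaLower`) for the spin-twisted torus at every twist, the second by taking adjoints in the first
(`H_L(U, φ)` is Hermitian, `spinTwistedHubbardTorus_isHermitian`). Yang, PRL 63 (1989) 2144,
eqs. (5)–(6). [folklore] -/
theorem spinTwistedHubbardTorus_mul_etaRaise_and_etaLower_mul (hL : Even L) (U : ℝ)
    (φ : Fin 2 → ℝ) :
    spinTwistedHubbardTorus L U φ * etaRaise torusStagger =
        (U : ℂ) • etaRaise torusStagger + etaRaise torusStagger * spinTwistedHubbardTorus L U φ ∧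
      etaLower torusStagger * spinTwistedHubbardTorus L U φ =
        (U : ℂ) • etaLower torusStagger +
          spinTwistedHubbardTorus L U φ * etaLower (torusStagger : FermionTorus 2 L → ℤˣ) := by
  have h1 : spinTwistedHubbardTorus L U φ * etaRaise torusStagger =
      (U : ℂ) • etaRaise torusStagger + etaRaise torusStagger * spinTwistedHubbardTorus L U φ :=
    sub_eq_iff_eq_add.1 (spinTwistedHubbardTorus_commutator_etaRaise hL U φ)
  have hHerm : (spinTwistedHubbardTorus L U φ)ᴴ = spinTwistedHubbardTorus L U φ :=
    (spinTwistedHubbardTorus_isHermitian L U φ).eq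
  refine ⟨h1, ?_⟩
  have := congrArg Matrix.conjTranspose h1
  simpa [Matrix.conjTranspose_mul, Matrix.conjTranspose_add, Matrix.conjTranspose_smul, hHerm,
    etaLower, Complex.star_def, Complex.conj_ofReal] using this

/-- **The pseudospin Casimir part `η†η` is conserved along the whole twist family.** For even
`L`, every `U` and every `φ ∈ ℝ²`, `[H_L(U, φ), η†η] = [H, η†]η + η†[H, η] = U η†η - U η†η = 0`: the
pseudospin `SU(2)` generated by `η†, η, η^z = (N̂ - L²)/2` is an exact symmetry of the spin-twisted
torus (the spin twist breaks only the SPIN `SU(2)`). Yang–Zhang, Mod. Phys. Lett. B 4 (1990) 759,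
Theorem 1; Zhang, PRL 65 (1990) 120. [folklore] -/
theorem spinTwistedHubbardTorus_commute_etaRaise_mul_etaLower (hL : Even L) (U : ℝ)
    (φ : Fin 2 → ℝ) :
    Commute (spinTwistedHubbardTorus L U φ)
      (etaRaise torusStagger * etaLower (torusStagger : FermionTorus 2 L → ℤˣ)) := by
  obtain ⟨h1, h3⟩ := spinTwistedHubbardTorus_mul_etaRaise_and_etaLower_mul hL U φ
  have h3' : spinTwistedHubbardTorus L U φ * etaLower (torusStagger : FermionTorus 2 L → ℤˣ) =
      etaLower torusStagger * spinTwistedHubbardTorus L U φ - (U : ℂ) • etaLower torusStagger := by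
    rw [h3]; abel
  show spinTwistedHubbardTorus L U φ * (etaRaise torusStagger * etaLower torusStagger) =
    etaRaise torusStagger * etaLower torusStagger * spinTwistedHubbardTorus L U φ
  rw [← mul_assoc, h1, add_mul, smul_mul_assoc, mul_assoc, h3', mul_sub, mul_smul_comm, ← mul_assoc]
  abel

end Literature.MathematicalPhysics.QuantumLattice

end
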